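import Summits.MatrixMultiplication.MatrixMultiplication.Theses.GLnSeparatingDesigns

/-!
# `FixedGroupBorderDesigns` — the proved glue of the support way-point (route GLnSeparatingDesigns)

Item `stmt-MatrixMultiplication-18363` (`FixedGroupBorderDesigns`, BCGPU 2024 §4 bullet 4, "a single, fixed
infinite group (say, GL₃)", border reading) is a SUPPORT way-point of route `GLnSeparatingDesigns`: one
fixed `n ≥ 3` whose `GL_n(ℂ)` carries, for every `δ > 0`, arbitrarily large `q` and every tolerance `η > 0`,
TPP designs of sizes `≥ q^((n²/2)(1−δ))` with `η`-approximate separating polynomials of degree `≤ q^(1+δ)`.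

This file lands the two transfer facts the route's rationale records as proved only in a planner folder
(`Sketch.lean: border_of_fixed`):

* `borderHalfDimensionDesigns_of_fixedGroupBorderDesigns` — the fixed-group family is a half-dimensional
  family in the sense of the crux `BorderHalfDimensionDesigns` (given `ε > 0` use the fixed `n` and, for a
  requested `δ`, run the fixed-group family at `δ' = min δ (2ε/n)`: then `(n²/2)(1−δ') ≥ n²/2 − εn` and
  `q^(1+δ') ≤ q^(1+δ)` for `q ≥ 1`, which is forced by asking for `q ≥ max q₀ 1`);
* `matrixMultiplication_of_fixedGroupBorderDesigns` — composed with the route's deciding theorem `closes`,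
  the fixed-group family plus the printed price `SeparationDegreeCost` (BCGPU 2024 Cor. 2.8 / Thm. 2.6) give
  `ω(ℂ) = 2`.

No statement is introduced here; both theorems only re-index the quantifiers of existing route decls.
-/

set_option linter.dupNamespace false

namespace Summit.MatrixMultiplication.MatrixMultiplication.Theorems.FixedGroupBorderDesigns

open Summit.MatrixMultiplication.MatrixMultiplication.Theses.GLnSeparatingDesigns

/-- **Fixed group ⇒ half-dimensional family.** If one fixed `GL_n(ℂ)` (`n ≥ 3`) carries TPP designs of
sizes `≥ q^((n²/2)(1−δ))` with `η`-approximate separators of degree `≤ q^(1+δ)` for every `δ > 0`,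
arbitrarily large `q` and every `η > 0` (`FixedGroupBorderDesigns`), then for every `ε > 0` some `n ≥ 3`
carries designs of sizes `≥ q^(n²/2 − εn)` with the same degree budget (`BorderHalfDimensionDesigns`):
take the same `n` and run the hypothesis at `δ' = min δ (2ε/n)` and threshold `max q₀ 1`. -/
theorem borderHalfDimensionDesigns_of_fixedGroupBorderDesigns (h : FixedGroupBorderDesigns) :
    BorderHalfDimensionDesigns := by
  intro ε hε
  obtain ⟨n, hn3, hn⟩ := h
  refine ⟨n, hn3, ?_⟩
  intro δ hδ q₀
  have hnpos : (0 : ℝ) < n := by exact_mod_cast (by omega : 0 < n)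
  obtain ⟨δ', hδ'def⟩ : ∃ δ' : ℝ, δ' = min δ (2 * ε / n) := ⟨_, rfl⟩
  have hδ'δ : δ' ≤ δ := hδ'def ▸ min_le_left _ _
  have hδ'ε : δ' ≤ 2 * ε / n := hδ'def ▸ min_le_right _ _
  have hδ'pos : 0 < δ' := hδ'def ▸ lt_min hδ (div_pos (by linarith) hnpos)
  obtain ⟨q, hq₀, hq⟩ := hn δ' hδ'pos (max q₀ 1)
  refine ⟨q, le_trans (le_max_left _ _) hq₀, ?_⟩
  intro η hη
  obtain ⟨X, Y, Z, htpp, hX, hY, hZ, hsep⟩ := hq η hη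
  have hq1 : (1 : ℝ) ≤ q := by exact_mod_cast le_trans (le_max_right q₀ 1) hq₀
  -- exponent comparison: n²/2 − εn ≤ (n²/2)(1 − δ')
  have hmul : (n : ℝ) ^ 2 / 2 * δ' ≤ ε * n := by
    have h1 : (n : ℝ) ^ 2 / 2 * δ' ≤ (n : ℝ) ^ 2 / 2 * (2 * ε / n) :=
      mul_le_mul_of_nonneg_left hδ'ε (by positivity)
    have h2 : (n : ℝ) ^ 2 / 2 * (2 * ε / n) = ε * n := by
      field_simp
    linarith
  have hexp : (n : ℝ) ^ 2 / 2 - ε * n ≤ (n : ℝ) ^ 2 / 2 * (1 - δ') := by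
    have e : (n : ℝ) ^ 2 / 2 * (1 - δ') = (n : ℝ) ^ 2 / 2 - (n : ℝ) ^ 2 / 2 * δ' := by ring
    rw [e]
    linarith
  have hsize : (q : ℝ) ^ ((n : ℝ) ^ 2 / 2 - ε * n) ≤ (q : ℝ) ^ ((n : ℝ) ^ 2 / 2 * (1 - δ')) :=
    Real.rpow_le_rpow_of_exponent_le hq1 hexp
  have hdeg : (q : ℝ) ^ (1 + δ') ≤ (q : ℝ) ^ (1 + δ) :=
    Real.rpow_le_rpow_of_exponent_le hq1 (by linarith)
  refine ⟨X, Y, Z, htpp, hsize.trans hX, hsize.trans hY, hsize.trans hZ, ?_⟩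
  intro x₀ hx₀ z₀ hz₀
  obtain ⟨p, hp, hsep'⟩ := hsep x₀ hx₀ z₀ hz₀
  exact ⟨p, hp.trans hdeg, hsep'⟩

/-- **Fixed group + printed price ⇒ ω(ℂ) = 2.** The fixed-group way-point composed with the route's
deciding theorem `closes`: `FixedGroupBorderDesigns` and the separation-degree price
`SeparationDegreeCost` (BCGPU 2024 Cor. 2.8 with its border clause) give the summit statement
`MatrixMultiplication` (`ω(ℂ) = 2`). -/
theorem matrixMultiplication_of_fixedGroupBorderDesigns (h₁ : FixedGroupBorderDesigns)
    (h₂ : SeparationDegreeCost) : MatrixMultiplication :=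
  closes (borderHalfDimensionDesigns_of_fixedGroupBorderDesigns h₁) h₂

end Summit.MatrixMultiplication.MatrixMultiplication.Theorems.FixedGroupBorderDesigns
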